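import Mathlib.RingTheory.Smooth.StandardSmoothCotangent
import Mathlib.RingTheory.Kaehler.Basic
import HarnessLib

/-!
# Points of standard smooth algebras of positive relative dimension carry non-zero point derivations

Topic `Literature/RingTheory/Smooth`. If `S` is a standard smooth `R`-algebra of relative dimension
`n ≥ 1` (Stacks Project, Tag 00T6) and `P : S → K` is a point with values in a field, then the
tangent space of `Spec S → Spec R` at `P` is non-zero: there is a non-zero point derivation
`D : S → K` at `P` over `R` (additive, `D(xy) = P(x) D(y) + P(y) D(x)`, `D|_R = 0`). Indeed
`Ω_{S/R}` is free of rank `n` on the differentials of the free variables of a submersive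
presentation (Stacks Project, Tag 00T7 (2); Mathlib `SubmersivePresentation.basisKaehler`), and a
coordinate function of that basis, composed with `P`, is a non-zero `S`-linear map `Ω_{S/R} → K`,
i.e. a non-zero derivation (universal property, Mathlib `KaehlerDifferential.linearMapEquivDerivation`).

* `exists_pointDerivation_ne_zero` — the statement above, in the "point derivation" format of
  `Literature.RingTheory.Smooth.exists_pointDerivation_comp_eq`.

This is the input "the point is not étale" of the residue-disc count
`Literature.RingTheory.CompleteLocalRings.not_countable_lifts_wittVector`.

## References

* The Stacks Project, Tags 00T6, 00T7 (standard smooth algebras and their differentials).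
  [StacksProject]
-/

noncomputable section

namespace Literature.RingTheory.Smooth

open Cardinal

/-- **Non-zero tangent vectors at points of positive relative dimension** (Stacks Project, Tag 00T7
(2): for a standard smooth `R`-algebra `S` the module `Ω_{S/R}` is free, of rank the relative
dimension). Let `S` be standard smooth of relative dimension `n ≥ 1` over `R` and `P : S → K` a
ring map to a field. Then there is an additive `D : S → K` with `D(xy) = P(x)D(y) + P(y)D(x)`,
`D ∘ (R → S) = 0` and `D ≠ 0`. [cite: StacksProject, Tag 00T7 (2)] -/
theorem exists_pointDerivation_ne_zero {R S K : Type*} [CommRing R] [CommRing S] [Algebra R S]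
    [Field K] (n : ℕ) (hn : 0 < n) [Algebra.IsStandardSmoothOfRelativeDimension n R S]
    (P : S →+* K) :
    ∃ D : S →+ K, (∀ x y, D (x * y) = P x * D y + P y * D x) ∧
      (∀ r, D (algebraMap R S r) = 0) ∧ ∃ x, D x ≠ 0 := by
  classical
  letI : Algebra S K := P.toAlgebra
  letI : Algebra R K := (P.comp (algebraMap R S)).toAlgebra
  haveI : IsScalarTower R S K := IsScalarTower.of_algebraMap_eq fun r => rfl
  haveI : Nontrivial S := P.domain_nontrivial
  obtain ⟨ι, σ, _, _, Pr, hPr⟩ := ‹Algebra.IsStandardSmoothOfRelativeDimension n R S›.out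
  let b := Pr.basisKaehler
  -- the free variables are non-empty since the rank `n` is positive
  obtain ⟨k₀⟩ : Nonempty ((Set.range Pr.map)ᶜ : Set ι) := by
    by_contra h
    rw [not_nonempty_iff] at h
    have h1 : Module.rank S Ω[S⁄R] = n :=
      Algebra.IsStandardSmoothOfRelativeDimension.rank_kaehlerDifferential n
    have h2 := b.mk_eq_rank
    rw [Cardinal.mk_eq_zero, Cardinal.lift_zero, h1, Cardinal.lift_natCast] at h2
    exact hn.ne' (by exact_mod_cast h2.symm)
  -- the derivation `x ↦ P (coordinate of dx along d(val k₀))`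
  let φ : Ω[S⁄R] →ₗ[S] K := (Algebra.linearMap S K) ∘ₗ (b.coord k₀)
  let D : Derivation R S K := KaehlerDifferential.linearMapEquivDerivation R S φ
  have hD : ∀ x, D x = φ (KaehlerDifferential.D R S x) := fun x => rfl
  refine ⟨D.toLinearMap.toAddMonoidHom, fun x y => ?_, fun r => D.map_algebraMap r, Pr.val k₀, ?_⟩
  · change D (x * y) = P x * D y + P y * D x
    rw [D.leibniz, Algebra.smul_def, Algebra.smul_def]
    rfl
  · change D (Pr.val k₀) ≠ 0
    rw [hD, ← Pr.basisKaehler_apply]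
    change algebraMap S K (b.repr (b k₀) k₀) ≠ 0
    rw [b.repr_self, Finsupp.single_eq_same, map_one]
    exact one_ne_zero

end Literature.RingTheory.Smooth

end
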